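import Summits.CriticalPhenomena.PercolationContinuityZ3.Theorems.PercNearOneGluingNoHeavyQuantSGCLightPairLayer
import Summits.CriticalPhenomena.PercolationContinuityZ3.Theorems.PercNearOneGluingNoHeavyQuantSGCLightCells
import Summits.CriticalPhenomena.PercolationContinuityZ3.Theorems.PercNearOneGluingNoHeavyQuantSGCLightPairPairTools
import Summits.CriticalPhenomena.PercolationContinuityZ3.Theorems.PercNearOneGluingNoHeavyQuantHeavyMixSingleGate
import Summits.CriticalPhenomena.PercolationContinuityZ3.Theorems.PercNearOneGluingNoHeavyQuantConvHeavy
import Summits.CriticalPhenomena.PercolationContinuityZ3.Theorems.PercNearOneGluingNoHeavyQuantLawDecFlowsDecomposition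
import HarnessLib

/-!
# QUANT lane R8, T-DEC, leg (III): **CELL L2 `LawDec.SGCLightPair` HOLDS** — the gated product of an admissible law with ONE light
# admissible top-affordable pair is DEC at every layer

builds on p205010 (kernel theorem, internal audit signed; external expert review pending)

Support file (`--supports stmt-CriticalPhenomena-4575`), QUANT lane seat prim-quant-arm-2 (gen 37), rung R8 of
`run/shared/lean/prim/quant/LADDER.md`.  Theorems only, standard axioms, no sorries.  Assembles parts 1–4 (`…QuantSGCLightPairPieces`,
`…Partial`, `…Remainder`, `…Layer`).  Memo `run/shared/lean/prim/quant/prim-quant-arm-2-g37/L2-TRANSPORT-G37.md`.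

THE CELL (typer g30, `…QuantSGCLightCells`; path (B) of lead g35's R8 map, HANDOFF GEN-35 addendum 3): `μ₁` a probability law on `{0..M₁}`
with `gate_q μ₁` top-affordable and DEC at every layer `j′ < M₁`; `{lo, hi; γ}` a LIGHT pair (`qγ < y`), top-affordable, with `gate_q {lo,hi;γ}`
DEC at every layer `j′ < M₂`; then `gate_q(μ₁ ∗ {lo,hi;γ})` is DEC at every layer `j′ < M₁ + M₂`.
THE PROOF.  By `lconv_TP`, `L = gate_q(μ₁ ∗ {lo,hi;γ}) = (1−q)δ₀ + (1−γ)·qμ₁(·−lo) + γ·qμ₁(·−hi)`, mass `1`, mean `q(T₁ + T₂)` — exactly the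
DEC target; the light pair's own admissibility gives `q·T₂ ≤ 2·lo` (`lightPair_two_lo_ge`, typer g31), and top-affordability gives `y ≤ q`;
`gate_q μ₁` has a flow at EVERY layer (the datum below `M₁`, Theorem A above: `decAtT_gate_of_allLayers`).  `flowAtT_lightPair_layer` (the
pooled two-copy gated-shift construction) then gives a flow of `L` at every layer, i.e. DEC (`decAtT_of_flowAtT`).  The degenerate first
factor `μ₁ = δ₀` (forced when its mean vanishes) makes `L = gate_q{lo,hi;γ}` and the claim is the pair's own datum.

* **`LawDec.sgcLightPair_holds : SGCLightPair`**.
HONEST STATUS: `SGCLightTriple` (cell L3), `WindowMixDEC`, `SingleGateConvClosed`, `TreeBuiltAD3`, `GateMove`, `FarTreeRow` remain OPEN; the RATE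
class log\* and the honest sentence of `run/shared/lean/prim/quant/README.md` are unchanged.

[this work]; the cell: typer g30; `lightPair_two_lo_ge`: typer g31; the one-copy gated-shift theorem whose construction this generalises:
typer g26 (this lane).  The gluing rows served [cite: KozmaNitzan2024, Conjecture 3 (p. 15)]; product measure [cite: Grimmett1999, §1.3 p. 10].
-/

noncomputable section

namespace Summit.CriticalPhenomena.PercolationContinuityZ3.Theorems

namespace Quant

open Finset

/-- two-point law notation `TP[lo, hi, g, h] = g·[h = hi] + (1 − g)·[h = lo]` (as in the lane's other files). -/
local notation3 "TP[" lo ", " hi ", " g ", " h "]" =>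
  (g : ℝ) * (if (h : ℕ) = (hi : ℕ) then (1 : ℝ) else 0) + (1 - (g : ℝ)) * (if (h : ℕ) = (lo : ℕ) then (1 : ℝ) else 0)

namespace LawDec

/-- **CELL L2 HOLDS: `LawDec.SGCLightPair`.** [this work] -/
theorem sgcLightPair_holds : SGCLightPair := by
  intro y q γ M₁ M₂ lo hi μ₁ hy0 hy1 hq0 hq1 hμ0 hμM hμ1 hta₁ hD₁ hlohi hhi hγ0 hγ1 hlight hta₂ hD₂ j' hj'
  classical
  set T₁ : ℝ := ∑ h ∈ Finset.range (M₁ + 1), (h : ℝ) * μ₁ h with hT₁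
  set T₂ : ℝ := (lo : ℝ) + ((hi : ℝ) - lo) * γ with hT₂
  set M : ℕ := M₁ + M₂ with hMdef
  set L : ℕ → ℝ := gate (lconv M₁ M₂ μ₁ (fun h => TP[lo, hi, γ, h])) q with hL
  /- ### scalars -/
  have hlo_r : (lo : ℝ) < hi := by exact_mod_cast hlohi
  have hT₂hi : T₂ ≤ hi := by rw [hT₂]; nlinarith
  have hT₂lo : (lo : ℝ) ≤ T₂ := by rw [hT₂]; nlinarith
  have hhiM₂ : (hi : ℝ) ≤ M₂ := by exact_mod_cast hhi
  have hyq : y ≤ q := by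
    have h1 : y * (M₂ : ℝ) ≤ q * (M₂ : ℝ) := le_trans hta₂ (by nlinarith)
    have hM₂pos : (0 : ℝ) < M₂ := by
      have : (1 : ℝ) ≤ hi := by exact_mod_cast (show 1 ≤ hi by omega)
      linarith
    exact le_of_mul_le_mul_right h1 hM₂pos
  have h2lo : q * T₂ ≤ 2 * (lo : ℝ) := lightPair_two_lo_ge y q γ M₂ lo hi hy1.le hlohi hhi hγ0 hγ1 hlight hD₂
  have hT₂pos : 0 < T₂ := by
    have : (0 : ℝ) < M₂ := by
      have : (1 : ℝ) ≤ hi := by exact_mod_cast (show 1 ≤ hi by omega)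
      linarith
    nlinarith
  have hlo1 : 1 ≤ lo := by
    by_contra hcon
    have hlo0 : lo = 0 := by omega
    rw [hlo0] at h2lo
    simp only [Nat.cast_zero, mul_zero] at h2lo
    nlinarith
  have hT₁nn : 0 ≤ T₁ := Finset.sum_nonneg fun h _ => mul_nonneg (Nat.cast_nonneg h) (hμ0 h)
  /- ### the law `L` -/
  obtain ⟨tp0, tpM, tp1, tpmean⟩ := twoPointMix_laws (ι := Unit) M₂ T₂ (fun _ => (1 : ℝ)) (fun _ => γ) (fun _ => lo)
    (fun _ => hi) (fun _ => zero_le_one) (by simp) (fun _ => ⟨hγ0, hγ1⟩) (fun _ => hlohi.le) (fun _ => hhi) (fun _ _ => rfl)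
  simp only [Finset.univ_unique, Finset.sum_singleton, one_mul] at tp0 tpM tp1 tpmean
  have hlconv0 : ∀ h, 0 ≤ lconv M₁ M₂ μ₁ (fun h => TP[lo, hi, γ, h]) h := fun h => lconv_nonneg M₁ M₂ _ _ hμ0 tp0 h
  have hlconvM : ∀ h, M < h → lconv M₁ M₂ μ₁ (fun h => TP[lo, hi, γ, h]) h = 0 := fun h hh => lconv_eq_zero M₁ M₂ _ _ h hh
  have hlconv1 : ∑ h ∈ Finset.range (M + 1), lconv M₁ M₂ μ₁ (fun h => TP[lo, hi, γ, h]) h = 1 := sum_lconv M₁ M₂ _ _ hμ1 tp1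
  have hlconvmean : ∑ h ∈ Finset.range (M + 1), (h : ℝ) * lconv M₁ M₂ μ₁ (fun h => TP[lo, hi, γ, h]) h = T₁ + T₂ := by
    rw [hMdef, sum_mul_lconv M₁ M₂ _ _ hμ1 tp1, tpmean]
  obtain ⟨L0nn, LM, L1⟩ := gate_laws M _ q hq0.le hq1 hlconv0 hlconvM hlconv1
  have Lmean : ∑ h ∈ Finset.range (M + 1), (h : ℝ) * L h = q * (T₁ + T₂) := by rw [hL, sum_mul_gate, hlconvmean]
  have hLval : ∀ t, L t = q * ((1 - γ) * (if lo ≤ t then μ₁ (t - lo) else 0) + γ * (if hi ≤ t then μ₁ (t - hi) else 0))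
      + (1 - q) * (if t = 0 then (1 : ℝ) else 0) := by
    intro t
    rw [hL, gate_apply, lconv_TP M₁ M₂ lo hi μ₁ γ hμM (by omega) hhi t]
  have hL0 : L 0 = 1 - q := by
    rw [hLval 0, if_neg (by omega), if_neg (by omega), if_pos rfl]; ring
  have hLt : ∀ t, 1 ≤ t → L t = (1 - γ) * (if lo ≤ t then q * μ₁ (t - lo) else 0) + γ * (if hi ≤ t then q * μ₁ (t - hi) else 0) := by
    intro t ht
    rw [hLval t, if_neg (show t ≠ 0 by omega)]
    split_ifs <;> ring
  have hta : y * (M : ℝ) ≤ q * T₁ + q * T₂ := by rw [hMdef]; push_cast; linarith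
  /- ### the goal as a flow statement -/
  rw [decAt_iff_decAtT, Lmean]
  by_cases hT₁0 : T₁ = 0
  · /- degenerate first factor: `μ₁ = δ₀`, `M₁ = 0`, `L = gate_q {lo,hi;γ}` -/
    have hM₁0 : M₁ = 0 := by
      by_contra hne
      have : (1 : ℝ) ≤ M₁ := by exact_mod_cast Nat.one_le_iff_ne_zero.2 hne
      rw [hT₁0] at hta₁
      nlinarith
    have hμpos : ∀ h, 1 ≤ h → μ₁ h = 0 := fun h hh => hμM h (by omega)
    have hμ00 : μ₁ 0 = 1 := by
      have := hμ1
      rw [hM₁0, Finset.sum_range_one] at this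
      exact this
    have hLeq : L = gate (fun h => TP[lo, hi, γ, h]) q := by
      funext t
      rw [hLval t, gate_apply]
      by_cases hlt : lo ≤ t
      · by_cases hht : hi ≤ t
        · rw [if_pos hlt, if_pos hht]
          by_cases h1 : t = hi
          · rw [h1, Nat.sub_self, hμ00, hμpos (hi - lo) (by omega), if_pos rfl, if_neg (show hi ≠ lo by omega),
              if_neg (show hi ≠ 0 by omega)]; ring
          · rw [hμpos (t - lo) (by omega), hμpos (t - hi) (by omega), if_neg h1, if_neg (by omega), if_neg (by omega)]; ring
        · rw [if_pos hlt, if_neg hht, if_neg (show t ≠ hi by omega), if_neg (show t ≠ 0 by omega)]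
          by_cases h1 : t = lo
          · rw [h1, Nat.sub_self, hμ00, if_pos rfl]; ring
          · rw [hμpos (t - lo) (by omega), if_neg h1]; ring
      · rw [if_neg hlt, if_neg (by omega), if_neg (show t ≠ hi by omega), if_neg (show t ≠ lo by omega)]
        split_ifs <;> ring
    have hmean₂ : ∑ h ∈ Finset.range (M₂ + 1), (h : ℝ) * gate (fun h => TP[lo, hi, γ, h]) q h = q * T₂ := by
      rw [sum_mul_gate, tpmean]
    have hj'' : j' < M₂ := by rw [hMdef, hM₁0, Nat.zero_add] at hj'; exact hj'
    have h := hD₂ j' hj''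
    rw [decAt_iff_decAtT, hmean₂] at h
    rw [hLeq, hT₁0, zero_add, hMdef, hM₁0, Nat.zero_add]
    exact h
  · /- generic first factor: `S = q·T₁ > 0` -/
    have hT₁pos : 0 < T₁ := lt_of_le_of_ne hT₁nn (Ne.symm hT₁0)
    have hS : 0 < q * T₁ := mul_pos hq0 hT₁pos
    -- flows of `gate_q μ₁` at every layer
    have hqx : q * (y / q) = y := mul_div_cancel₀ y (ne_of_gt hq0)
    have hF : ∀ J, FlowAtT y (q * T₁) J M₁ (gate μ₁ q) := by
      intro J
      have h := decAtT_gate_of_allLayers (y / q) q M₁ M₁ J μ₁ (div_pos hy0 hq0) hq0 hq1 (by rw [hqx]; exact hy1) hμ0 hμM hμ1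
        (by rw [div_mul_eq_mul_div, div_le_iff₀ hq0]; linarith) (by rw [hqx]; exact hD₁) le_rfl
      rw [hqx] at h
      exact flowAtT_of_decAtT y _ J M₁ _ hy0 hy1 h
    have hflow := flowAtT_lightPair_layer y (q * T₁) (q * T₂) q γ j' lo hi M₁ M μ₁ L hy0 hy1 hq0 hyq hγ0 hγ1 hS
      (by positivity) h2lo hlo1 hlohi.le (by omega) hj' hμ0 hμ1 hF L0nn hL0 hLt L1 (by rw [Lmean]; ring) (by linarith)
    rw [show q * (T₁ + T₂) = q * T₁ + q * T₂ by ring]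
    exact decAtT_of_flowAtT y _ j' M L hy0 hy1 LM L1 hflow

end LawDec

end Quant

end Summit.CriticalPhenomena.PercolationContinuityZ3.Theorems
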